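import Literature.Analysis.Hypoelliptic.WeightedL2
import Literature.Analysis.Distribution.EllipticRegularity
import Mathlib.Analysis.Calculus.ContDiff.Bounds
import Mathlib.Analysis.InnerProductSpace.Calculus
import Mathlib.Analysis.Complex.OperatorNorm
import HarnessLib

/-!
# Amplitudes with compact `x`-support and the twisted calculus of a differential operator

Analysis/Hypoelliptic support file serving the discharge of the named fact
`Literature.Analysis.Distribution.Folland1995_cor634` (Folland 1995, Cor. (6.34): elliptic
operators with smooth coefficients are hypoelliptic) by a crude parametrix: the operators
`φ ↦ (x ↦ ∫ e^{2πi⟨ξ,x⟩} a(x, ξ) 𝓕φ(ξ) dξ)` for amplitudes `a(x, ξ)` which are smooth, compactly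
supported in `x`, and whose `x`-derivatives are `O(⟨ξ⟩^m)`.

* `IsAmp a m` ("`a` is an amplitude of order `m`"): `a : V → V → ℂ` is jointly smooth, the
  slices `a(·, ξ)` are supported in a fixed compact set, and
  `‖D_x^N a(·, ξ)‖ ≤ C_N ⟨ξ⟩^m` for every `N`. Closure under sums, scalars, multiplication by
  smooth functions of `x` (order unchanged), by the linear symbols `⟨ξ, Z x⟩` of smooth vector
  fields `Z` (order `+ 1`), and under differentiation along smooth vector fields (order
  unchanged).
* The **twisted calculus**: conjugating the first-order operators of the transpose
  `ᵗL = ∑_w ᵗX_w (a_w ·)` of `Literature/Analysis/Distribution/EllipticRegularity.lean` by the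
  phase `e^{2πi⟨ξ, x⟩}` gives the operators `twD`, `twT`, `twW`, `twOp` on amplitudes
  (`e^{-2πi⟨ξ,x⟩} Z_x (e^{2πi⟨ξ,x⟩} a) = 2πi⟨ξ, Z x⟩ a + Z_x a`), which raise the order by
  the order of the operator, and the **principal part**: `twOp a = σ̃ · a + r` with
  `σ̃(x, ξ) = ∑_{|w| = k} a_w(x) ∏_{i ∈ w} (-2πi⟨ξ, X_i x⟩)` (`= (-2πi)^k ×` the principal symbol)
  and `r` of order `m + k - 1` (`twOp_principal`).

## References

* G. B. Folland, *Introduction to Partial Differential Equations*, 2nd ed. (1995), Ch. 6 §C.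
* M. E. Taylor, *Pseudodifferential Operators* (1981), Ch. II §§1–4 (amplitudes, composition
  with differential operators; folklore).
-/

noncomputable section

open MeasureTheory Set Filter Function TopologicalSpace
open scoped Topology InnerProductSpace BigOperators ContDiff ComplexConjugate

namespace Literature.Analysis.Hypoelliptic

open Literature.Analysis.Distribution

variable {V : Type*} [NormedAddCommGroup V] [InnerProductSpace ℝ V]

/-! ### Amplitudes of order `m` -/

/-- **Amplitudes of order `m` with compact `x`-support**: `a(x, ξ)` is jointly smooth, the
slices `x ↦ a(x, ξ)` are supported in one compact set, and `‖D_x^N a(·, ξ)(x)‖ ≤ C_N ⟨ξ⟩^m`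
for every `N` (symbols of order `m` in `ξ` as far as `x`-derivatives are concerned; no
regularity in `ξ` beyond smoothness is recorded). [folklore] -/
structure IsAmp (a : V → V → ℂ) (m : ℝ) : Prop where
  smooth : ContDiff ℝ ∞ (uncurry a)
  supp : ∃ K : Set V, IsCompact K ∧ ∀ ξ, tsupport (fun x => a x ξ) ⊆ K
  bound : ∀ N : ℕ, ∃ C : ℝ, 0 ≤ C ∧ ∀ x ξ, ‖iteratedFDeriv ℝ N (fun y => a y ξ) x‖ ≤ C * bw m ξ

namespace IsAmp

variable {a b : V → V → ℂ} {m m' : ℝ}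

/-- The `x`-slices of an amplitude are smooth. [folklore] -/
theorem slice (h : IsAmp a m) (ξ : V) : ContDiff ℝ ∞ (fun x => a x ξ) :=
  h.smooth.comp (contDiff_prodMk_left ξ)

/-- The `ξ`-slices of an amplitude are smooth. [folklore] -/
theorem slice' (h : IsAmp a m) (x : V) : ContDiff ℝ ∞ (fun ξ => a x ξ) :=
  h.smooth.comp (contDiff_prodMk_right x)

/-- An amplitude is jointly continuous. [folklore] -/
theorem continuous (h : IsAmp a m) : Continuous (uncurry a) := h.smooth.continuous

/-- The pointwise bound `‖a x ξ‖ ≤ C₀ ⟨ξ⟩^m`. [folklore] -/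
theorem norm_le (h : IsAmp a m) : ∃ C : ℝ, 0 ≤ C ∧ ∀ x ξ, ‖a x ξ‖ ≤ C * bw m ξ := by
  obtain ⟨C, hC, h0⟩ := h.bound 0
  exact ⟨C, hC, fun x ξ => by simpa [norm_iteratedFDeriv_zero] using h0 x ξ⟩

/-- Outside the compact support the slices and all their derivatives vanish. [folklore] -/
theorem iteratedFDeriv_eq_zero {K : Set V} (hK : ∀ ξ, tsupport (fun x => a x ξ) ⊆ K) {x : V}
    (hx : x ∉ K) (N : ℕ) (ξ : V) : iteratedFDeriv ℝ N (fun y => a y ξ) x = 0 := by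
  have hx' : x ∉ tsupport (fun y => a y ξ) := fun h' => hx (hK ξ h')
  by_contra hne
  exact hx' (support_iteratedFDeriv_subset N (mem_support.2 hne))

/-- Weakening the order. [folklore] -/
theorem mono (h : IsAmp a m) (hm : m ≤ m') : IsAmp a m' where
  smooth := h.smooth
  supp := h.supp
  bound N := by
    obtain ⟨C, hC, hb⟩ := h.bound N
    exact ⟨C, hC, fun x ξ => (hb x ξ).trans (mul_le_mul_of_nonneg_left (bw_mono hm ξ) hC)⟩

/-- The zero amplitude. [folklore] -/
theorem zero (m : ℝ) : IsAmp (fun _ _ : V => (0 : ℂ)) m where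
  smooth := contDiff_const
  supp := ⟨∅, isCompact_empty, fun ξ => by simp⟩
  bound N := ⟨0, le_rfl, fun x ξ => by simp⟩

/-- Sums of amplitudes. [folklore] -/
theorem add (ha : IsAmp a m) (hb : IsAmp b m) : IsAmp (fun x ξ => a x ξ + b x ξ) m where
  smooth := ha.smooth.add hb.smooth
  supp := by
    obtain ⟨K₁, hK₁, h₁⟩ := ha.supp
    obtain ⟨K₂, hK₂, h₂⟩ := hb.supp
    refine ⟨K₁ ∪ K₂, hK₁.union hK₂, fun ξ => ?_⟩
    refine (closure_mono (support_add (fun x => a x ξ) (fun x => b x ξ))).trans ?_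
    rw [closure_union]
    exact union_subset_union (h₁ ξ) (h₂ ξ)
  bound N := by
    obtain ⟨C₁, hC₁, h₁⟩ := ha.bound N
    obtain ⟨C₂, hC₂, h₂⟩ := hb.bound N
    refine ⟨C₁ + C₂, add_nonneg hC₁ hC₂, fun x ξ => ?_⟩
    have e : (fun y => a y ξ + b y ξ) = (fun y => a y ξ) + fun y => b y ξ := rfl
    rw [e, iteratedFDeriv_add_apply ((ha.slice ξ).contDiffAt.of_le (mod_cast le_top))
      ((hb.slice ξ).contDiffAt.of_le (mod_cast le_top)), add_mul]
    exact (norm_add_le _ _).trans (add_le_add (h₁ x ξ) (h₂ x ξ))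

/-- Scalar multiples of amplitudes. [folklore] -/
theorem const_mul (ha : IsAmp a m) (c : ℂ) : IsAmp (fun x ξ => c * a x ξ) m where
  smooth := contDiff_const.mul ha.smooth
  supp := by
    obtain ⟨K, hK, h⟩ := ha.supp
    exact ⟨K, hK, fun ξ => (tsupport_mul_subset_right (f := fun _ : V => c) (g := fun x => a x ξ)).trans (h ξ)⟩
  bound N := by
    obtain ⟨C, hC, h⟩ := ha.bound N
    refine ⟨‖c‖ * C, mul_nonneg (norm_nonneg c) hC, fun x ξ => ?_⟩
    have e : (fun y => c * a y ξ) = c • fun y => a y ξ := rfl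
    rw [e, iteratedFDeriv_const_smul_apply ((ha.slice ξ).contDiffAt.of_le (mod_cast le_top)), norm_smul,
      mul_assoc]
    exact mul_le_mul_of_nonneg_left (h x ξ) (norm_nonneg c)

/-- Negatives of amplitudes. [folklore] -/
theorem neg (ha : IsAmp a m) : IsAmp (fun x ξ => -a x ξ) m := by
  have := ha.const_mul (-1); simpa using this

/-- Differences of amplitudes. [folklore] -/
theorem sub (ha : IsAmp a m) (hb : IsAmp b m) : IsAmp (fun x ξ => a x ξ - b x ξ) m := by
  have := ha.add hb.neg; simpa [sub_eq_add_neg] using this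

/-- Finite sums of amplitudes. [folklore] -/
theorem sum {κ : Type*} (s : Finset κ) {f : κ → V → V → ℂ} (hf : ∀ i ∈ s, IsAmp (f i) m) :
    IsAmp (fun x ξ => ∑ i ∈ s, f i x ξ) m := by
  classical
  induction s using Finset.induction_on with
  | empty => simpa using zero m
  | insert i s his ih =>
    have h := (hf i (Finset.mem_insert_self i s)).add (ih fun j hj => hf j (Finset.mem_insert_of_mem hj))
    simpa [Finset.sum_insert his] using h

/-! ### Multiplication by smooth functions of `x` and by linear symbols; differentiation -/

/-- Sup bounds for the derivatives of a smooth function on a compact set, all orders at once.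
[folklore] -/
theorem exists_forall_norm_iteratedFDeriv_le {W : Type*} [NormedAddCommGroup W] [NormedSpace ℝ W]
    {g : V → W} (hg : ContDiff ℝ ∞ g) {K : Set V} (hK : IsCompact K) :
    ∃ G : ℕ → ℝ, (∀ i, 0 ≤ G i) ∧ ∀ i, ∀ x ∈ K, ‖iteratedFDeriv ℝ i g x‖ ≤ G i := by
  have h : ∀ i : ℕ, ∃ G : ℝ, ∀ x ∈ K, ‖iteratedFDeriv ℝ i g x‖ ≤ G := fun i =>
    hK.exists_bound_of_continuousOn ((hg.continuous_iteratedFDeriv (mod_cast le_top)).continuousOn)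
  choose G hG using h
  exact ⟨fun i => max (G i) 0, fun i => le_max_right _ _, fun i x hx => (hG i x hx).trans (le_max_left _ _)⟩

/-- **Multiplication by a smooth function of `x`** keeps the order. [folklore] -/
theorem smul_fun (ha : IsAmp a m) {g : V → ℂ} (hg : ContDiff ℝ ∞ g) :
    IsAmp (fun x ξ => g x * a x ξ) m where
  smooth := (hg.comp contDiff_fst).mul ha.smooth
  supp := by
    obtain ⟨K, hK, h⟩ := ha.supp
    exact ⟨K, hK, fun ξ => (tsupport_mul_subset_right (f := g) (g := fun x => a x ξ)).trans (h ξ)⟩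
  bound N := by
    obtain ⟨K, hK, hKs⟩ := ha.supp
    obtain ⟨G, hG0, hG⟩ := exists_forall_norm_iteratedFDeriv_le hg hK
    choose C hC0 hC using ha.bound
    refine ⟨∑ i ∈ Finset.range (N + 1), (N.choose i : ℝ) * G i * C (N - i),
      Finset.sum_nonneg fun i _ => by have h0 := hG0 i; have h0' := hC0 (N - i); positivity, fun x ξ => ?_⟩
    by_cases hx : x ∈ K
    · have hL := norm_iteratedFDeriv_mul_le hg (ha.slice ξ) x (n := N) (mod_cast le_top)
      refine hL.trans ?_
      rw [Finset.sum_mul]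
      refine Finset.sum_le_sum fun i _ => ?_
      have h1 := hG i x hx
      have h2 := hC (N - i) x ξ
      have h0 := hG0 i; have h0' := hC0 (N - i)
      calc (N.choose i : ℝ) * ‖iteratedFDeriv ℝ i g x‖ * ‖iteratedFDeriv ℝ (N - i) (fun y => a y ξ) x‖
          ≤ (N.choose i : ℝ) * G i * (C (N - i) * bw m ξ) :=
            mul_le_mul (mul_le_mul_of_nonneg_left h1 (Nat.cast_nonneg _)) h2 (norm_nonneg _) (by positivity)
        _ = _ := by ring
    · have hsupp : ∀ ξ, tsupport (fun y => g y * a y ξ) ⊆ K := fun ξ =>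
        (tsupport_mul_subset_right (f := g) (g := fun x => a x ξ)).trans (hKs ξ)
      rw [iteratedFDeriv_eq_zero hsupp hx N ξ, norm_zero]
      exact mul_nonneg (Finset.sum_nonneg fun i _ => by have h0 := hG0 i; have h0' := hC0 (N - i); positivity)
        (bw_nonneg _ _)

/-- Multiplication by a smooth real function of `x`. [folklore] -/
theorem smul_fun_real (ha : IsAmp a m) {g : V → ℝ} (hg : ContDiff ℝ ∞ g) :
    IsAmp (fun x ξ => (g x : ℂ) * a x ξ) m :=
  ha.smul_fun (g := fun x => (g x : ℂ)) (Complex.ofRealCLM.contDiff.comp hg)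

/-- A smooth compactly supported function of `x` alone is an amplitude of order `0`. [folklore] -/
theorem of_fun {g : V → ℂ} (hg : ContDiff ℝ ∞ g) (hs : HasCompactSupport g) :
    IsAmp (fun x _ => g x) 0 where
  smooth := hg.comp contDiff_fst
  supp := ⟨tsupport g, hs, fun _ => Subset.rfl⟩
  bound N := by
    obtain ⟨G, hG0, hG⟩ := exists_forall_norm_iteratedFDeriv_le hg hs
    refine ⟨G N, hG0 N, fun x ξ => ?_⟩
    rw [bw_zero, mul_one]
    by_cases hx : x ∈ tsupport g
    · exact hG N x hx
    · have : iteratedFDeriv ℝ N g x = 0 := by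
        by_contra hne
        exact hx (support_iteratedFDeriv_subset N (mem_support.2 hne))
      rw [this, norm_zero]
      exact hG0 N

/-- A smooth compactly supported real function of `x` alone is an amplitude of order `0`.
[folklore] -/
theorem of_fun_real {g : V → ℝ} (hg : ContDiff ℝ ∞ g) (hs : HasCompactSupport g) :
    IsAmp (fun x _ => (g x : ℂ)) 0 :=
  of_fun (Complex.ofRealCLM.contDiff.comp hg) (hs.comp_left Complex.ofReal_zero)

/-- The derivatives of the linear symbol `x ↦ ⟨ξ, Z x⟩` (complexified) are `≤ ‖ξ‖ ‖D^i Z x‖`.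
[folklore] -/
theorem norm_iteratedFDeriv_inner_le {Z : V → V} (hZ : ContDiff ℝ ∞ Z) (ξ x : V) (i : ℕ) :
    ‖iteratedFDeriv ℝ i (fun y => ((⟪ξ, Z y⟫_ℝ : ℝ) : ℂ)) x‖ ≤ ‖ξ‖ * ‖iteratedFDeriv ℝ i Z x‖ := by
  have e : (fun y => ((⟪ξ, Z y⟫_ℝ : ℝ) : ℂ)) = Complex.ofRealCLM ∘ (innerSL ℝ ξ ∘ Z) := by
    ext y; simp
  rw [e]
  have h1 := Complex.ofRealCLM.norm_iteratedFDeriv_comp_left (f := innerSL ℝ ξ ∘ Z) (x := x)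
    (n := i) (((innerSL ℝ ξ).contDiff.comp hZ).contDiffAt) (mod_cast le_top)
  have h2 := (innerSL ℝ ξ).norm_iteratedFDeriv_comp_left (f := Z) (x := x) (n := i)
    hZ.contDiffAt (mod_cast le_top)
  rw [Complex.ofRealCLM_norm, one_mul] at h1
  rw [innerSL_apply_norm] at h2
  exact h1.trans h2

/-- **Multiplication by the linear symbol `⟨ξ, Z x⟩`** of a smooth vector field raises the
order by one. [folklore] -/
theorem mul_inner (ha : IsAmp a m) {Z : V → V} (hZ : ContDiff ℝ ∞ Z) :
    IsAmp (fun x ξ => ((⟪ξ, Z x⟫_ℝ : ℝ) : ℂ) * a x ξ) (m + 1) where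
  smooth := by
    have h1 : ContDiff ℝ ∞ fun p : V × V => ((⟪p.2, Z p.1⟫_ℝ : ℝ) : ℂ) :=
      Complex.ofRealCLM.contDiff.comp (contDiff_snd.inner ℝ (hZ.comp contDiff_fst))
    exact h1.mul ha.smooth
  supp := by
    obtain ⟨K, hK, h⟩ := ha.supp
    exact ⟨K, hK, fun ξ => (tsupport_mul_subset_right (f := fun x => ((⟪ξ, Z x⟫_ℝ : ℝ) : ℂ))
      (g := fun x => a x ξ)).trans (h ξ)⟩
  bound N := by
    obtain ⟨K, hK, hKs⟩ := ha.supp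
    obtain ⟨G, hG0, hG⟩ := exists_forall_norm_iteratedFDeriv_le hZ hK
    choose C hC0 hC using ha.bound
    set B : ℝ := ∑ i ∈ Finset.range (N + 1), (N.choose i : ℝ) * G i * C (N - i) with hB
    have hB0 : 0 ≤ B := Finset.sum_nonneg fun i _ => by have h0 := hG0 i; have h0' := hC0 (N - i); positivity
    refine ⟨B, hB0, fun x ξ => ?_⟩
    have hlin : ContDiff ℝ ∞ fun y => ((⟪ξ, Z y⟫_ℝ : ℝ) : ℂ) :=
      Complex.ofRealCLM.contDiff.comp (contDiff_const.inner ℝ hZ)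
    by_cases hx : x ∈ K
    · have hL := norm_iteratedFDeriv_mul_le hlin (ha.slice ξ) x (n := N) (mod_cast le_top)
      refine hL.trans ?_
      have hmain : ∑ i ∈ Finset.range (N + 1), (N.choose i : ℝ) *
          ‖iteratedFDeriv ℝ i (fun y => ((⟪ξ, Z y⟫_ℝ : ℝ) : ℂ)) x‖ *
            ‖iteratedFDeriv ℝ (N - i) (fun y => a y ξ) x‖ ≤ B * (‖ξ‖ * bw m ξ) := by
        rw [hB, Finset.sum_mul]
        refine Finset.sum_le_sum fun i _ => ?_
        have h1 := (norm_iteratedFDeriv_inner_le hZ ξ x i).trans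
          (mul_le_mul_of_nonneg_left (hG i x hx) (norm_nonneg ξ))
        have h2 := hC (N - i) x ξ
        have h0 := hG0 i; have h0' := hC0 (N - i)
        calc (N.choose i : ℝ) * ‖iteratedFDeriv ℝ i (fun y => ((⟪ξ, Z y⟫_ℝ : ℝ) : ℂ)) x‖ *
              ‖iteratedFDeriv ℝ (N - i) (fun y => a y ξ) x‖
            ≤ (N.choose i : ℝ) * (‖ξ‖ * G i) * (C (N - i) * bw m ξ) :=
              mul_le_mul (mul_le_mul_of_nonneg_left h1 (Nat.cast_nonneg _)) h2 (norm_nonneg _) (by positivity)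
          _ = _ := by ring
      refine hmain.trans (mul_le_mul_of_nonneg_left ?_ hB0)
      calc ‖ξ‖ * bw m ξ ≤ bw 1 ξ * bw m ξ := mul_le_mul_of_nonneg_right (norm_le_bw_one ξ) (bw_nonneg _ _)
        _ = bw (m + 1) ξ := by rw [← bw_add, add_comm]
    · have hsupp : ∀ ξ, tsupport (fun y => ((⟪ξ, Z y⟫_ℝ : ℝ) : ℂ) * a y ξ) ⊆ K := fun ξ =>
        (tsupport_mul_subset_right (f := fun x => ((⟪ξ, Z x⟫_ℝ : ℝ) : ℂ)) (g := fun x => a x ξ)).trans (hKs ξ)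
      rw [iteratedFDeriv_eq_zero hsupp hx N ξ, norm_zero]
      exact mul_nonneg hB0 (bw_nonneg _ _)

/-- The derivative of a slice through the joint derivative. [folklore] -/
theorem fderiv_slice (h : ContDiff ℝ ∞ (uncurry a)) (x ξ : V) :
    fderiv ℝ (fun y => a y ξ) x = (fderiv ℝ (uncurry a) (x, ξ)).comp (ContinuousLinearMap.inl ℝ V V) := by
  have h1 : HasFDerivAt (uncurry a) (fderiv ℝ (uncurry a) (x, ξ)) (x, ξ) :=
    ((h.differentiable (by simp)) (x, ξ)).hasFDerivAt
  have h2 := h1.comp x (hasFDerivAt_prodMk_left (𝕜 := ℝ) x ξ)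
  exact h2.fderiv

/-- **Differentiation along a smooth vector field** keeps the order. [folklore] -/
theorem dC (ha : IsAmp a m) {Z : V → V} (hZ : ContDiff ℝ ∞ Z) :
    IsAmp (fun x ξ => fderiv ℝ (fun y => a y ξ) x (Z x)) m where
  smooth := by
    have e : (fun p : V × V => fderiv ℝ (fun y => a y p.2) p.1 (Z p.1)) =
        fun p : V × V => (fderiv ℝ (uncurry a) p) (ContinuousLinearMap.inl ℝ V V (Z p.1)) := by
      ext ⟨x, ξ⟩
      rw [fderiv_slice ha.smooth x ξ]
      rfl
    change ContDiff ℝ ∞ fun p : V × V => fderiv ℝ (fun y => a y p.2) p.1 (Z p.1)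
    rw [e]
    have h1 : ContDiff ℝ ∞ (fderiv ℝ (uncurry a)) := ha.smooth.fderiv_right (m := ∞) (mod_cast le_top)
    exact h1.clm_apply ((ContinuousLinearMap.inl ℝ V V).contDiff.comp (hZ.comp contDiff_fst))
  supp := by
    obtain ⟨K, hK, h⟩ := ha.supp
    refine ⟨K, hK, fun ξ => ?_⟩
    have h1 : support (fun x => fderiv ℝ (fun y => a y ξ) x (Z x)) ⊆ support (fderiv ℝ fun y => a y ξ) := by
      intro x hx
      rw [mem_support] at hx ⊢
      intro h0; exact hx (by rw [h0]; rfl)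
    exact (closure_mono h1).trans ((tsupport_fderiv_subset ℝ).trans (h ξ))
  bound N := by
    obtain ⟨K, hK, hKs⟩ := ha.supp
    obtain ⟨G, hG0, hG⟩ := exists_forall_norm_iteratedFDeriv_le hZ hK
    choose C hC0 hC using ha.bound
    set B : ℝ := ∑ i ∈ Finset.range (N + 1), (N.choose i : ℝ) * C (i + 1) * G (N - i) with hB
    have hB0 : 0 ≤ B := Finset.sum_nonneg fun i _ => by have h0 := hG0 (N - i); have h0' := hC0 (i + 1); positivity
    refine ⟨B, hB0, fun x ξ => ?_⟩
    by_cases hx : x ∈ K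
    · have hf : ContDiff ℝ ∞ (fderiv ℝ fun y => a y ξ) := (ha.slice ξ).fderiv_right (m := ∞) (mod_cast le_top)
      have hL := norm_iteratedFDeriv_clm_apply hf hZ x (n := N) (mod_cast le_top)
      refine hL.trans ?_
      rw [hB, Finset.sum_mul]
      refine Finset.sum_le_sum fun i _ => ?_
      rw [norm_iteratedFDeriv_fderiv]
      have h1 := hC (i + 1) x ξ
      have h2 := hG (N - i) x hx
      have h0 := hG0 (N - i); have h0' := hC0 (i + 1); have hbw := bw_nonneg m ξ
      calc (N.choose i : ℝ) * ‖iteratedFDeriv ℝ (i + 1) (fun y => a y ξ) x‖ * ‖iteratedFDeriv ℝ (N - i) Z x‖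
          ≤ (N.choose i : ℝ) * (C (i + 1) * bw m ξ) * G (N - i) :=
            mul_le_mul (mul_le_mul_of_nonneg_left h1 (Nat.cast_nonneg _)) h2 (norm_nonneg _) (by positivity)
        _ = _ := by ring
    · have hsupp : ∀ ξ, tsupport (fun x => fderiv ℝ (fun y => a y ξ) x (Z x)) ⊆ K := by
        intro ξ
        have h1 : support (fun x => fderiv ℝ (fun y => a y ξ) x (Z x)) ⊆ support (fderiv ℝ fun y => a y ξ) := by
          intro x hx
          rw [mem_support] at hx ⊢
          intro h0; exact hx (by rw [h0]; rfl)
        exact (closure_mono h1).trans ((tsupport_fderiv_subset ℝ).trans (hKs ξ))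
      rw [iteratedFDeriv_eq_zero hsupp hx N ξ, norm_zero]
      exact mul_nonneg hB0 (bw_nonneg _ _)

end IsAmp

/-! ### The twisted calculus -/

section Twist

/-- **Twisted derivative** along `Z`: `e^{-2πi⟨ξ,x⟩} Z_x (e^{2πi⟨ξ,x⟩} a) = 2πi⟨ξ, Z x⟩ a + Z_x a`.
[folklore] -/
def twD (Z : V → V) (a : V → V → ℂ) : V → V → ℂ := fun x ξ =>
  (2 * Real.pi * Complex.I) * ((⟪ξ, Z x⟫_ℝ : ℝ) : ℂ) * a x ξ + fderiv ℝ (fun y => a y ξ) x (Z x)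

/-- **Twisted formal transpose** of `Z`: `e^{-2πi⟨ξ,x⟩} ᵗZ_x (e^{2πi⟨ξ,x⟩} a) = -twD Z a - (div Z) a`.
[folklore] -/
def twT (Z : V → V) (a : V → V → ℂ) : V → V → ℂ := fun x ξ =>
  -twD Z a x ξ - (fieldDiv Z x : ℂ) * a x ξ

variable {ι : Type*}

/-- Twisted transposed word `e^{-2πi⟨ξ,x⟩} (ᵗX_{i_k} ⋯ ᵗX_{i_1}) e^{2πi⟨ξ,x⟩}` (same recursion as
`wordTranspose`). [folklore] -/
def twW (Y : ι → V → V) : List ι → (V → V → ℂ) → V → V → ℂ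
  | [], a => a
  | i :: w, a => twW Y w (twT (Y i) a)

/-- Twisted transposed operator `e^{-2πi⟨ξ,x⟩} ᵗL_x e^{2πi⟨ξ,x⟩}` for `ᵗL g = ∑_{w ∈ S} ᵗX_w (b_w g)`.
[folklore] -/
def twOp (Y : ι → V → V) (S : Finset (List ι)) (b : List ι → V → ℝ) (a : V → V → ℂ) : V → V → ℂ :=
  fun x ξ => ∑ w ∈ S, twW Y w (fun y η => (b w y : ℂ) * a y η) x ξ

/-- The principal factor of `ᵗZ`: `λ_Z(x, ξ) = -2πi⟨ξ, Z x⟩`. [folklore] -/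
def lam (Z : V → V) (x ξ : V) : ℂ := -(2 * Real.pi * Complex.I) * ((⟪ξ, Z x⟫_ℝ : ℝ) : ℂ)

/-- The principal factor of a transposed word: `Λ_w = ∏_{i ∈ w} λ_{X_i}`. [folklore] -/
def Lam (Y : ι → V → V) (w : List ι) (x ξ : V) : ℂ := (w.map fun i => lam (Y i) x ξ).prod

/-- **The twisted principal symbol** `σ̃(x, ξ) = ∑_{w ∈ S, |w| = k} b_w(x) Λ_w(x, ξ)`
(`= (-2πi)^k ×` the principal symbol of order `k`). [folklore] -/
def twSymb (Y : ι → V → V) (S : Finset (List ι)) (b : List ι → V → ℝ) (k : ℕ) (x ξ : V) : ℂ :=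
  ∑ w ∈ S with w.length = k, (b w x : ℂ) * Lam Y w x ξ

/-- (structural lemma) [folklore] -/
@[simp] theorem twW_nil (Y : ι → V → V) (a : V → V → ℂ) : twW Y [] a = a := rfl

/-- (structural lemma) [folklore] -/
@[simp] theorem twW_cons (Y : ι → V → V) (i : ι) (w : List ι) (a : V → V → ℂ) :
    twW Y (i :: w) a = twW Y w (twT (Y i) a) := rfl

/-- (structural lemma) [folklore] -/
@[simp] theorem Lam_nil (Y : ι → V → V) (x ξ : V) : Lam Y [] x ξ = 1 := by simp [Lam]

/-- (structural lemma) [folklore] -/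
@[simp] theorem Lam_cons (Y : ι → V → V) (i : ι) (w : List ι) (x ξ : V) :
    Lam Y (i :: w) x ξ = lam (Y i) x ξ * Lam Y w x ξ := by simp [Lam]

/-- The twisted derivative is `λ`-principal: `twD Z a = -λ_Z a + Z_x a`. [folklore] -/
theorem twD_eq (Z : V → V) (a : V → V → ℂ) (x ξ : V) :
    twD Z a x ξ = -lam Z x ξ * a x ξ + fderiv ℝ (fun y => a y ξ) x (Z x) := by
  simp only [twD, lam]; ring

variable [FiniteDimensional ℝ V] {a : V → V → ℂ} {m : ℝ}

omit [FiniteDimensional ℝ V] in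
/-- `twD` raises the order by one. [folklore] -/
theorem isAmp_twD (ha : IsAmp a m) {Z : V → V} (hZ : ContDiff ℝ ∞ Z) : IsAmp (twD Z a) (m + 1) := by
  have h1 := ((ha.mul_inner hZ).const_mul (2 * Real.pi * Complex.I)).add ((ha.dC hZ).mono (by linarith : m ≤ m + 1))
  have e : twD Z a = fun x ξ => 2 * Real.pi * Complex.I * (((⟪ξ, Z x⟫_ℝ : ℝ) : ℂ) * a x ξ) +
      fderiv ℝ (fun y => a y ξ) x (Z x) := by
    ext x ξ; simp only [twD]; ring
  rw [e]; exact h1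

/-- `twT` raises the order by one. [folklore] -/
theorem isAmp_twT (ha : IsAmp a m) {Z : V → V} (hZ : ContDiff ℝ ∞ Z) : IsAmp (twT Z a) (m + 1) := by
  have h1 := (isAmp_twD ha hZ).neg.sub ((ha.smul_fun_real (contDiff_fieldDiv hZ)).mono (by linarith : m ≤ m + 1))
  exact h1

/-- **The twisted transpose is `λ`-principal**: `twT Z a = λ_Z · a + ρ` with `ρ = -Z_x a - (div Z) a`
of order `m`. [folklore] -/
theorem twT_principal (ha : IsAmp a m) {Z : V → V} (hZ : ContDiff ℝ ∞ Z) :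
    ∃ ρ : V → V → ℂ, IsAmp ρ m ∧ twT Z a = fun x ξ => lam Z x ξ * a x ξ + ρ x ξ := by
  refine ⟨fun x ξ => -fderiv ℝ (fun y => a y ξ) x (Z x) - (fieldDiv Z x : ℂ) * a x ξ,
    (ha.dC hZ).neg.sub (ha.smul_fun_real (contDiff_fieldDiv hZ)), ?_⟩
  ext x ξ
  simp only [twT, twD_eq]
  ring

omit [FiniteDimensional ℝ V] in
/-- Multiplication by `Λ_w` raises the order by `|w|`. [folklore] -/
theorem isAmp_mul_Lam {Y : ι → V → V} (hY : ∀ i, ContDiff ℝ ∞ (Y i)) :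
    ∀ (w : List ι) {a : V → V → ℂ} {m : ℝ}, IsAmp a m →
      IsAmp (fun x ξ => Lam Y w x ξ * a x ξ) (m + w.length)
  | [], a, m, ha => by simpa using ha
  | i :: w, a, m, ha => by
    have ih := isAmp_mul_Lam hY w ha
    have h1 := (ih.mul_inner (hY i)).const_mul (-(2 * Real.pi * Complex.I))
    have e : (fun x ξ => -(2 * Real.pi * Complex.I) * (((⟪ξ, Y i x⟫_ℝ : ℝ) : ℂ) * (Lam Y w x ξ * a x ξ))) =
        fun x ξ => Lam Y (i :: w) x ξ * a x ξ := by
      ext x ξ; simp only [Lam_cons, lam]; ring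
    rw [e] at h1
    have e2 : m + (w.length : ℝ) + 1 = m + ((i :: w).length : ℝ) := by
      rw [List.length_cons]; push_cast; ring
    rw [e2] at h1
    exact h1

/-- `twW` raises the order by the length of the word. [folklore] -/
theorem isAmp_twW {Y : ι → V → V} (hY : ∀ i, ContDiff ℝ ∞ (Y i)) :
    ∀ (w : List ι) {a : V → V → ℂ} {m : ℝ}, IsAmp a m → IsAmp (twW Y w a) (m + w.length)
  | [], a, m, ha => by simpa using ha
  | i :: w, a, m, ha => by
    have h := isAmp_twW hY w (isAmp_twT ha (hY i))
    have e : m + 1 + (w.length : ℝ) = m + ((i :: w).length : ℝ) := by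
      rw [List.length_cons]; push_cast; ring
    rw [twW_cons, ← e]
    exact h

/-- **Principal part of a twisted word**: `twW w a = Λ_w · a + r` with `r` of order
`m + |w| - 1`. [folklore] -/
theorem twW_principal {Y : ι → V → V} (hY : ∀ i, ContDiff ℝ ∞ (Y i)) :
    ∀ (w : List ι) {a : V → V → ℂ} {m : ℝ}, IsAmp a m →
      ∃ r : V → V → ℂ, IsAmp r (m + w.length - 1) ∧
        twW Y w a = fun x ξ => Lam Y w x ξ * a x ξ + r x ξ
  | [], a, m, ha => ⟨fun _ _ => 0, by simpa using IsAmp.zero (m + 0 - 1), by ext x ξ; simp⟩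
  | i :: w, a, m, ha => by
    obtain ⟨ρ, hρ, hρe⟩ := twT_principal ha (hY i)
    obtain ⟨r₁, hr₁, hr₁e⟩ := twW_principal hY w (isAmp_twT ha (hY i))
    have hΛρ := isAmp_mul_Lam hY w hρ
    have e1 : m + (w.length : ℝ) = m + ((i :: w).length : ℝ) - 1 := by
      rw [List.length_cons]; push_cast; ring
    have e2 : m + 1 + (w.length : ℝ) - 1 = m + ((i :: w).length : ℝ) - 1 := by
      rw [List.length_cons]; push_cast; ring
    rw [e1] at hΛρ
    rw [e2] at hr₁
    refine ⟨fun x ξ => Lam Y w x ξ * ρ x ξ + r₁ x ξ, hΛρ.add hr₁, ?_⟩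
    rw [twW_cons, hr₁e]
    ext x ξ
    have hx := congrFun (congrFun hρe x) ξ
    rw [hx, Lam_cons]
    ring

/-- `twOp` raises the order by `k` when all words have length `≤ k`. [folklore] -/
theorem isAmp_twOp {Y : ι → V → V} (hY : ∀ i, ContDiff ℝ ∞ (Y i)) {S : Finset (List ι)}
    {b : List ι → V → ℝ} (hb : ∀ w, ContDiff ℝ ∞ (b w)) {k : ℕ} (hS : ∀ w ∈ S, w.length ≤ k)
    (ha : IsAmp a m) : IsAmp (twOp Y S b a) (m + k) := by
  unfold twOp
  refine IsAmp.sum S fun w hw => ?_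
  have h := isAmp_twW hY w (ha.smul_fun_real (hb w))
  refine h.mono ?_
  have : (w.length : ℝ) ≤ k := by exact_mod_cast hS w hw
  linarith

/-- **Principal part of the twisted operator**: if every word of `S` has length `≤ k` then
`twOp a = σ̃ · a + r` with `r` of order `m + k - 1`. [folklore] -/
theorem twOp_principal {Y : ι → V → V} (hY : ∀ i, ContDiff ℝ ∞ (Y i)) {S : Finset (List ι)}
    {b : List ι → V → ℝ} (hb : ∀ w, ContDiff ℝ ∞ (b w)) {k : ℕ} (hS : ∀ w ∈ S, w.length ≤ k)
    (ha : IsAmp a m) :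
    ∃ r : V → V → ℂ, IsAmp r (m + k - 1) ∧
      twOp Y S b a = fun x ξ => twSymb Y S b k x ξ * a x ξ + r x ξ := by
  classical
  -- principal parts word by word
  have hw : ∀ w : List ι, ∃ r : V → V → ℂ, IsAmp r (m + w.length - 1) ∧
      twW Y w (fun y η => (b w y : ℂ) * a y η) = fun x ξ => Lam Y w x ξ * ((b w x : ℂ) * a x ξ) + r x ξ :=
    fun w => twW_principal hY w (ha.smul_fun_real (hb w))
  choose r hr hre using hw
  -- the lower-order part of the sum of principal factors
  set low : V → V → ℂ := fun x ξ => ∑ w ∈ S with ¬ w.length = k, Lam Y w x ξ * ((b w x : ℂ) * a x ξ) with hlow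
  have hlowA : IsAmp low (m + k - 1) := by
    refine IsAmp.sum _ fun w hw => ?_
    have hwS : w ∈ S := (Finset.mem_filter.1 hw).1
    have hne : w.length ≠ k := (Finset.mem_filter.1 hw).2
    have hlt : w.length + 1 ≤ k := Nat.lt_of_le_of_ne (hS w hwS) hne
    have h := isAmp_mul_Lam hY w (ha.smul_fun_real (hb w))
    refine h.mono ?_
    have : (w.length : ℝ) + 1 ≤ k := by exact_mod_cast hlt
    linarith
  have hrA : IsAmp (fun x ξ => ∑ w ∈ S, r w x ξ) (m + k - 1) := by
    refine IsAmp.sum S fun w hw => (hr w).mono ?_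
    have : (w.length : ℝ) ≤ k := by exact_mod_cast hS w hw
    linarith
  refine ⟨fun x ξ => low x ξ + ∑ w ∈ S, r w x ξ, hlowA.add hrA, ?_⟩
  ext x ξ
  simp only [twOp, twSymb]
  have e1 : ∑ w ∈ S, twW Y w (fun y η => (b w y : ℂ) * a y η) x ξ =
      ∑ w ∈ S, (Lam Y w x ξ * ((b w x : ℂ) * a x ξ) + r w x ξ) :=
    Finset.sum_congr rfl fun w _ => by rw [hre w]
  rw [e1, Finset.sum_add_distrib, ← Finset.sum_filter_add_sum_filter_not S (fun w => w.length = k)]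
  simp only [hlow, Finset.sum_mul]
  have e3 : ∀ w ∈ S.filter (fun w => w.length = k), (b w x : ℂ) * Lam Y w x ξ * a x ξ =
      Lam Y w x ξ * ((b w x : ℂ) * a x ξ) := fun w _ => by ring
  rw [Finset.sum_congr rfl e3]
  ring

end Twist

/-! ### The complexified transposes on the `x`-side and their realness -/

section XSide

variable {ι : Type*}

/-- Directional derivative of a complex function along a vector field: `Z_x h = Dh(x) · Z x`.
[folklore] -/
def dirC (Z : V → V) (h : V → ℂ) : V → ℂ := fun x => fderiv ℝ h x (Z x)

/-- Complexified formal transpose of a vector field: `ᵗZ h = -Z h - (div Z) h`. [folklore] -/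
def trC (Z : V → V) (h : V → ℂ) : V → ℂ := fun x => -dirC Z h x - (fieldDiv Z x : ℂ) * h x

/-- Complexified transposed word (same recursion as `wordTranspose`). [folklore] -/
def wtrC (Y : ι → V → V) : List ι → (V → ℂ) → V → ℂ
  | [], h => h
  | i :: w, h => wtrC Y w (trC (Y i) h)

/-- Complexified transposed operator `ᵗL h = ∑_{w ∈ S} ᵗX_w (b_w h)` (same formula as
`smoothDiffOpTranspose`, acting on complex-valued functions). [folklore] -/
def opC (Y : ι → V → V) (S : Finset (List ι)) (b : List ι → V → ℝ) (h : V → ℂ) : V → ℂ :=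
  fun x => ∑ w ∈ S, wtrC Y w (fun y => (b w y : ℂ) * h y) x

/-- (structural lemma) [folklore] -/
@[simp] theorem wtrC_nil (Y : ι → V → V) (h : V → ℂ) : wtrC Y [] h = h := rfl

/-- (structural lemma) [folklore] -/
@[simp] theorem wtrC_cons (Y : ι → V → V) (i : ι) (w : List ι) (h : V → ℂ) :
    wtrC Y (i :: w) h = wtrC Y w (trC (Y i) h) := rfl

/-- `dirC` preserves smoothness. [folklore] -/
theorem contDiff_dirC {Z : V → V} (hZ : ContDiff ℝ ∞ Z) {h : V → ℂ} (hh : ContDiff ℝ ∞ h) :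
    ContDiff ℝ ∞ (dirC Z h) :=
  (hh.fderiv_right (m := ∞) (mod_cast le_top)).clm_apply hZ

/-- `dirC` is additive on differentiable functions. [folklore] -/
theorem dirC_add (Z : V → V) {h g : V → ℂ} (hh : Differentiable ℝ h) (hg : Differentiable ℝ g) :
    dirC Z (fun x => h x + g x) = fun x => dirC Z h x + dirC Z g x := by
  ext x; simp only [dirC]; rw [fderiv_fun_add (hh x) (hg x)]; rfl

/-- `dirC` is homogeneous on differentiable functions. [folklore] -/
theorem dirC_const_mul (Z : V → V) (c : ℂ) {h : V → ℂ} (hh : Differentiable ℝ h) :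
    dirC Z (fun x => c * h x) = fun x => c * dirC Z h x := by
  ext x; simp only [dirC]; rw [fderiv_const_mul (hh x)]; rfl

/-- `dirC` of a real function is the real directional derivative. [folklore] -/
theorem dirC_ofReal (Z : V → V) {φ : V → ℝ} (hφ : Differentiable ℝ φ) :
    dirC Z (fun x => (φ x : ℂ)) = fun x => (fieldDeriv Z φ x : ℂ) := by
  ext x
  simp only [dirC, fieldDeriv_apply]
  have h2 : HasFDerivAt (fun y => (φ y : ℂ)) (Complex.ofRealCLM.comp (fderiv ℝ φ x)) x :=
    Complex.ofRealCLM.hasFDerivAt.comp x (hφ x).hasFDerivAt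
  rw [h2.fderiv]; rfl

variable [FiniteDimensional ℝ V]

/-- `trC` preserves smoothness. [folklore] -/
theorem contDiff_trC {Z : V → V} (hZ : ContDiff ℝ ∞ Z) {h : V → ℂ} (hh : ContDiff ℝ ∞ h) :
    ContDiff ℝ ∞ (trC Z h) :=
  (contDiff_dirC hZ hh).neg.sub ((Complex.ofRealCLM.contDiff.comp (contDiff_fieldDiv hZ)).mul hh)

omit [FiniteDimensional ℝ V] in
/-- `trC` is additive on smooth functions. [folklore] -/
theorem trC_add (Z : V → V) {h g : V → ℂ} (hh : ContDiff ℝ ∞ h) (hg : ContDiff ℝ ∞ g) :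
    trC Z (fun x => h x + g x) = fun x => trC Z h x + trC Z g x := by
  ext x; simp only [trC]
  rw [dirC_add Z (hh.differentiable (by simp)) (hg.differentiable (by simp))]; ring

omit [FiniteDimensional ℝ V] in
/-- `trC` is homogeneous on smooth functions. [folklore] -/
theorem trC_const_mul (Z : V → V) (c : ℂ) {h : V → ℂ} (hh : ContDiff ℝ ∞ h) :
    trC Z (fun x => c * h x) = fun x => c * trC Z h x := by
  ext x; simp only [trC]
  rw [dirC_const_mul Z c (hh.differentiable (by simp))]; ring

omit [FiniteDimensional ℝ V] in
/-- `trC` of a real function is the real formal transpose. [folklore] -/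
theorem trC_ofReal (Z : V → V) {φ : V → ℝ} (hφ : Differentiable ℝ φ) :
    trC Z (fun x => (φ x : ℂ)) = fun x => (fieldTranspose Z φ x : ℂ) := by
  ext x; simp only [trC, fieldTranspose, dirC_ofReal Z hφ]; push_cast; ring

/-- `wtrC` preserves smoothness. [folklore] -/
theorem contDiff_wtrC {Y : ι → V → V} (hY : ∀ i, ContDiff ℝ ∞ (Y i)) :
    ∀ (w : List ι) {h : V → ℂ}, ContDiff ℝ ∞ h → ContDiff ℝ ∞ (wtrC Y w h)
  | [], _, hh => hh
  | i :: w, _, hh => contDiff_wtrC hY w (contDiff_trC (hY i) hh)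

/-- `wtrC` is additive on smooth functions. [folklore] -/
theorem wtrC_add {Y : ι → V → V} (hY : ∀ i, ContDiff ℝ ∞ (Y i)) :
    ∀ (w : List ι) {h g : V → ℂ}, ContDiff ℝ ∞ h → ContDiff ℝ ∞ g →
      wtrC Y w (fun x => h x + g x) = fun x => wtrC Y w h x + wtrC Y w g x
  | [], _, _, _, _ => rfl
  | i :: w, _, _, hh, hg => by
    rw [wtrC_cons, trC_add (Y i) hh hg, wtrC_add hY w (contDiff_trC (hY i) hh) (contDiff_trC (hY i) hg)]
    rfl

/-- `wtrC` is homogeneous on smooth functions. [folklore] -/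
theorem wtrC_const_mul {Y : ι → V → V} (hY : ∀ i, ContDiff ℝ ∞ (Y i)) (c : ℂ) :
    ∀ (w : List ι) {h : V → ℂ}, ContDiff ℝ ∞ h →
      wtrC Y w (fun x => c * h x) = fun x => c * wtrC Y w h x
  | [], _, _ => rfl
  | i :: w, _, hh => by
    rw [wtrC_cons, trC_const_mul (Y i) c hh, wtrC_const_mul hY c w (contDiff_trC (hY i) hh)]
    rfl

/-- `wtrC` of a real function is the real transposed word. [folklore] -/
theorem wtrC_ofReal {Y : ι → V → V} (hY : ∀ i, ContDiff ℝ ∞ (Y i)) :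
    ∀ (w : List ι) {φ : V → ℝ}, ContDiff ℝ ∞ φ →
      wtrC Y w (fun x => (φ x : ℂ)) = fun x => (wordTranspose Y w φ x : ℂ) := by
  intro w
  induction w with
  | nil => intro φ _; rfl
  | cons i w ih =>
    intro φ hφ
    rw [wtrC_cons, trC_ofReal (Y i) (hφ.differentiable (by simp)), ih (contDiff_fieldTranspose (hY i) hφ)]
    rfl

/-- `opC` preserves smoothness. [folklore] -/
theorem contDiff_opC {Y : ι → V → V} (hY : ∀ i, ContDiff ℝ ∞ (Y i)) {S : Finset (List ι)}
    {b : List ι → V → ℝ} (hb : ∀ w, ContDiff ℝ ∞ (b w)) {h : V → ℂ} (hh : ContDiff ℝ ∞ h) :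
    ContDiff ℝ ∞ (opC Y S b h) := by
  unfold opC
  exact ContDiff.sum fun w _ => contDiff_wtrC hY w ((Complex.ofRealCLM.contDiff.comp (hb w)).mul hh)

/-- `opC` is additive on smooth functions. [folklore] -/
theorem opC_add {Y : ι → V → V} (hY : ∀ i, ContDiff ℝ ∞ (Y i)) {S : Finset (List ι)}
    {b : List ι → V → ℝ} (hb : ∀ w, ContDiff ℝ ∞ (b w)) {h g : V → ℂ} (hh : ContDiff ℝ ∞ h)
    (hg : ContDiff ℝ ∞ g) :
    opC Y S b (fun x => h x + g x) = fun x => opC Y S b h x + opC Y S b g x := by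
  ext x
  simp only [opC, ← Finset.sum_add_distrib]
  refine Finset.sum_congr rfl fun w _ => ?_
  have hb' : ContDiff ℝ ∞ fun y => (b w y : ℂ) := Complex.ofRealCLM.contDiff.comp (hb w)
  have e : (fun y => (b w y : ℂ) * (h y + g y)) = fun y => (b w y : ℂ) * h y + (b w y : ℂ) * g y := by
    ext y; ring
  rw [e, wtrC_add hY w (hb'.mul hh) (hb'.mul hg)]

/-- `opC` is homogeneous on smooth functions. [folklore] -/
theorem opC_const_mul {Y : ι → V → V} (hY : ∀ i, ContDiff ℝ ∞ (Y i)) {S : Finset (List ι)}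
    {b : List ι → V → ℝ} (hb : ∀ w, ContDiff ℝ ∞ (b w)) (c : ℂ) {h : V → ℂ} (hh : ContDiff ℝ ∞ h) :
    opC Y S b (fun x => c * h x) = fun x => c * opC Y S b h x := by
  ext x
  simp only [opC, Finset.mul_sum]
  refine Finset.sum_congr rfl fun w _ => ?_
  have hb' : ContDiff ℝ ∞ fun y => (b w y : ℂ) := Complex.ofRealCLM.contDiff.comp (hb w)
  have e : (fun y => (b w y : ℂ) * (c * h y)) = fun y => c * ((b w y : ℂ) * h y) := by ext y; ring
  rw [e, wtrC_const_mul hY c w (hb'.mul hh)]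

/-- **Realness**: `opC` of a real function is the real transposed operator
`smoothDiffOpTranspose`. [folklore] -/
theorem opC_ofReal {Y : ι → V → V} (hY : ∀ i, ContDiff ℝ ∞ (Y i)) (S : Finset (List ι))
    {b : List ι → V → ℝ} (hb : ∀ w, ContDiff ℝ ∞ (b w)) {φ : V → ℝ} (hφ : ContDiff ℝ ∞ φ) :
    opC Y S b (fun x => (φ x : ℂ)) = fun x => (smoothDiffOpTranspose Y S b φ x : ℂ) := by
  ext x
  simp only [opC, smoothDiffOpTranspose]
  push_cast
  refine Finset.sum_congr rfl fun w _ => ?_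
  have e : (fun y => (b w y : ℂ) * (φ y : ℂ)) = fun y => ((b w y * φ y : ℝ) : ℂ) := by
    ext y; push_cast; ring
  rw [e, wtrC_ofReal hY w ((hb w).mul hφ)]

/-- **Real and imaginary parts**: for smooth complex `h`,
`Re (opC h) = smoothDiffOpTranspose (Re h)` and `Im (opC h) = smoothDiffOpTranspose (Im h)`.
[folklore] -/
theorem opC_re_im {Y : ι → V → V} (hY : ∀ i, ContDiff ℝ ∞ (Y i)) (S : Finset (List ι))
    {b : List ι → V → ℝ} (hb : ∀ w, ContDiff ℝ ∞ (b w)) {h : V → ℂ} (hh : ContDiff ℝ ∞ h) :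
    opC Y S b h = fun x => (smoothDiffOpTranspose Y S b (fun y => (h y).re) x : ℂ) +
      Complex.I * (smoothDiffOpTranspose Y S b (fun y => (h y).im) x : ℂ) := by
  have hre : ContDiff ℝ ∞ fun y => (h y).re := Complex.reCLM.contDiff.comp hh
  have him : ContDiff ℝ ∞ fun y => (h y).im := Complex.imCLM.contDiff.comp hh
  have hreC : ContDiff ℝ ∞ fun y => ((h y).re : ℂ) := Complex.ofRealCLM.contDiff.comp hre
  have himC : ContDiff ℝ ∞ fun y => ((h y).im : ℂ) := Complex.ofRealCLM.contDiff.comp him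
  have eh : h = fun y => ((h y).re : ℂ) + Complex.I * ((h y).im : ℂ) := by
    ext y; rw [mul_comm]; exact (Complex.re_add_im (h y)).symm
  conv_lhs => rw [eh]
  rw [opC_add hY hb hreC (contDiff_const.mul himC), opC_const_mul hY hb Complex.I himC,
    opC_ofReal hY S hb hre, opC_ofReal hY S hb him]

/-- `Re (opC h) = smoothDiffOpTranspose (Re h)`. [folklore] -/
theorem opC_re {Y : ι → V → V} (hY : ∀ i, ContDiff ℝ ∞ (Y i)) (S : Finset (List ι))
    {b : List ι → V → ℝ} (hb : ∀ w, ContDiff ℝ ∞ (b w)) {h : V → ℂ} (hh : ContDiff ℝ ∞ h) (x : V) :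
    (opC Y S b h x).re = smoothDiffOpTranspose Y S b (fun y => (h y).re) x := by
  rw [opC_re_im hY S hb hh]
  simp

/-- `Im (opC h) = smoothDiffOpTranspose (Im h)`. [folklore] -/
theorem opC_im {Y : ι → V → V} (hY : ∀ i, ContDiff ℝ ∞ (Y i)) (S : Finset (List ι))
    {b : List ι → V → ℝ} (hb : ∀ w, ContDiff ℝ ∞ (b w)) {h : V → ℂ} (hh : ContDiff ℝ ∞ h) (x : V) :
    (opC Y S b h x).im = smoothDiffOpTranspose Y S b (fun y => (h y).im) x := by
  rw [opC_re_im hY S hb hh]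
  simp

end XSide

end Literature.Analysis.Hypoelliptic
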